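/-
Copyright (c) 2026 the pub-hodgecm-mathlib formalisation cell (harness21).  Prover seat hodgecm-mathlib-K2E3-p17 (g7), Track B «K2-LIT» ∕ h413
(`stmt-HodgeConjecture-24833`), line `K2_E3_EllipticInputs`, unit U12 §L, road «GL-[M6]-sc» (owner K2E3-p23 (g5)), MEMO «M6sc-BLUEPRINT v4» §2 brick T15-log
(SPLIT HALF), part 1 of 2: «THE VANDERMONDE SINGULAR INTEGRAL `∫_{(𝔭^n)³} ‖Δ(d)‖^{-a} dd` IS FINITE FOR `a < 1/2`» + the Borel slice `b(r)` has `disc χ = Δ²`.  2026-09-04.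
-/
import Summits.HodgeConjecture.HodgeConjecture.Theorems.K2E3GL3SplitTorusWeylKit        -- ★ H1a p857820: `discr_charpoly_diagonal`; brings the local-field kit (`primePowBall`, `normAbs`, …)
import Literature.NumberTheory.Automorphic.LocalFieldHaarNegPower                   -- ★ `LocalFieldHaar.lintegral_coe_normAbs_rpow_neg_lt_top` (`∫_{𝔭ⁿ} ‖x‖^{-s} < ∞`, `s < 1`)
import Summits.HodgeConjecture.HodgeConjecture.Theorems.K2E3GL3ParahoricLevelMeasureLemmas -- ★ (K2E3 §L kit): `sub_mem_primePowBall`; brings ★ `add_mem_primePowBall` (AddCharConductorExponent)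
import Literature.NumberTheory.Automorphic.TateLocalZetaShells                       -- ★ `measurableSet_primePowBall`, `measure_primePowBall_lt_top`, `secondCountableTopology_localField`
import Mathlib.MeasureTheory.Integral.Marginal
import HarnessLib

/-!
# K2_E3 road (h413), §L — brick T15-log (split half), part 1: `∫_{(𝔭^n)³} ‖d₀−d₁‖^{-a} ‖d₀−d₂‖^{-a} ‖d₁−d₂‖^{-a} dd < ∞` for `a < 1/2`, and `disc χ_{b(r)} = Δ(r₀,r₃,r₅)²`

Cell `pub/hodgecm-mathlib` (D-0151), Track B, seat K2E3-p17 (g7); MEMO «M6sc-BLUEPRINT v4» (K2E3-p23 (g5)) §0.3 ∕ §2 «T15-log (a)» (road owner RULINGS #12 (M12-2)).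
`--supports stmt-HodgeConjecture-24833 --as helper`; THEOREMS ONLY (no definition ∕ instance ∕ notation ∕ named fact ∕ `sorry`); never imports `Cruxes/…/Lines`.
COUNT-NEUTRAL.  Consumer: part 2 `K2E3GL3SplitDiscriminantLocIntegrable` (Harish-Chandra's Theorem 15 for the split Cartan of `GL₃`, on the Lie algebra).

THE MATHEMATICS (the elementary singular integral behind Harish-Chandra's Thm. 15 ∕ [HC1999] Lemma 7.9 for the split torus of `𝔤𝔩₃`).  §1: on the local field,
`∫ 1_{𝔭^n}(t) g(t − c) dt = ∫_{𝔭^n} g` for `c ∈ 𝔭^n` (translation; `𝔭^n` is a group, ★ `sub_mem_primePowBall`), `uv ≤ u² + v²`, hence `∫ 1_{𝔭^n}(t)‖t−c₁‖^{-a}‖t−c₂‖^{-a} dt ≤ 2 I(2a)`,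
`I(s) := ∫_{𝔭^n} ‖u‖^{-s} du` (finite for `s < 1`, ★ `LocalFieldHaarNegPower`).  §2: peeling `d₀` then `d₁` (Mathlib `lmarginal`),
`∫_{(𝔭^n)³} ‖d₀−d₁‖^{-a}‖d₀−d₂‖^{-a}‖d₁−d₂‖^{-a} dd ≤ 2 I(2a) I(a) dx(𝔭^n) < ∞` for `a < 1/2`.  §3: the Borel slice `b(r) = [[r₀,r₁,r₂],[0,r₃,r₄],[0,0,r₅]]` is upper
triangular, `χ_{b(r)} = χ_{diag(r₀,r₃,r₅)}`, so `disc χ_{b(r)} = Δ(r₀,r₃,r₅)²` with `Δ(d) = (d₀−d₁)(d₀−d₂)(d₁−d₂)` (★ H1a).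
[HarishChandra1970, Part V §6 Thm. 15 p. 63] [HarishChandra1999AdmissibleDistributions, Lemma 7.9, §15] [Tate1950, §2.4] [WeilBNT1967, Ch. I §2–§4]
HONEST LABEL: HC_CM is proved only modulo the 7 printed citations (2 remaining named inputs: hLiu418 = stmt-HodgeConjecture-24832, h413 = stmt-HodgeConjecture-24833)
until rung 0 closes; count-neutral helper.

## Mathlib ∕ tree search
Tree: ★ H1a `K2E3GL3SplitTorusWeylKit.discr_charpoly_diagonal`, ★ `LocalFieldHaar.lintegral_coe_normAbs_rpow_neg_lt_top`, ★ `add_mem_primePowBall`, ★ `K2E3GL3ParahoricLevelMeasureLemmas.sub_mem_primePowBall`,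
★ `measurable_normAbs`, ★ `measurableSet_primePowBall`, ★ `measure_primePowBall_lt_top`.  Mathlib: `lmarginal_insert'`, `lmarginal_singleton`, `lmarginal_mono`,
`lintegral_eq_lmarginal_univ`, `lintegral_add_left_eq_self`, `Matrix.charpoly_of_upperTriangular`, `Matrix.charpoly_diagonal`, `ENNReal.rpow_mul`, `ENNReal.rpow_two`.
Dedup: `rg "vandermonde_rpow|normAbs_sub_rpow_neg|charpoly_borelSlice|discr_charpoly_borelSlice"` over Literature∕Summits — no hits; `sub_mem_primePowBall` reused from ★ `K2E3GL3ParahoricLevelMeasureLemmas`, `uv ≤ u²+v²` (★ `Literature.Analysis.FluidPDE.ennreal_mul_le_sq_add_sq`) kept as an inline `have` (no fluid-PDE import).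

## References
* [HarishChandra1970] Harish-Chandra (van Dijk), *Harmonic Analysis on Reductive p-adic Groups*, LNM 162 (1970), Part V §6 Thm. 15.
* [HarishChandra1999AdmissibleDistributions] Harish-Chandra (DeBacker–Sally), *Admissible Invariant Distributions on Reductive p-adic Groups* (1999), Lemma 7.9, §15.
* [Tate1950] J. Tate, *Fourier analysis in number fields and Hecke's zeta-functions* (1950), §2.4.
* [WeilBNT1967] A. Weil, *Basic Number Theory* (1967), Ch. I §2–§4.
-/

set_option autoImplicit false
set_option linter.dupNamespace false

noncomputable section

open MeasureTheory MeasureTheory.Measure Set Matrix Topology Polynomial Filter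
open scoped MatrixGroups NNReal ENNReal
open Literature.NumberTheory.GaloisRepresentations Literature.NumberTheory.GaloisRepresentations.IsNonarchimedeanLocalField
open Literature.NumberTheory.Automorphic Literature.NumberTheory.Automorphic.LocalFieldHaar
open Summit.HodgeConjecture.HodgeConjecture.Cruxes.H413.K2E3GL3SplitTorusWeylKit

namespace Summit.HodgeConjecture.HodgeConjecture.Cruxes.H413.K2E3GL3SplitDiscriminantBoxIntegral

/-! ## §1  One-variable kit on the local field `F` -/

section OneVariable

variable {F : Type*} [Field F] [ValuativeRel F] [TopologicalSpace F] [IsNonarchimedeanLocalField F]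

/-- Translating `𝔭^n` by an element of `𝔭^n` does not move it: `c + x ∈ 𝔭^n ↔ x ∈ 𝔭^n` for `c ∈ 𝔭^n`. [cite: WeilBNT1967, Ch. I §2] -/
theorem add_mem_primePowBall_iff_of_mem {n : ℤ} {c x : F} (hc : c ∈ primePowBall F n) : c + x ∈ primePowBall F n ↔ x ∈ primePowBall F n := by
  refine ⟨fun h => ?_, fun h => add_mem_primePowBall hc h⟩
  have h' := K2E3GL3ParahoricLevelMeasureLemmas.sub_mem_primePowBall h hc
  rwa [add_sub_cancel_left] at h'

/-- `(x^{-a})² = x^{-2a}` in `ℝ≥0∞`. [folklore] -/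
theorem rpow_neg_sq (x : ℝ≥0∞) (a : ℝ) : (x ^ (-a)) ^ 2 = x ^ (-(2 * a)) := by
  rw [← ENNReal.rpow_two, ← ENNReal.rpow_mul]
  congr 1
  ring

variable [MeasurableSpace F] [BorelSpace F] (dx : Measure F) [dx.IsAddHaarMeasure]

/-- **Translation inside a ball**: for `c ∈ 𝔭^n`, `∫ 1_{𝔭^n}(t) g(t − c) dt = ∫_{𝔭^n} g(u) du` (`t = c + u`; `𝔭^n` is a subgroup). [cite: WeilBNT1967, Ch. I §2] -/
theorem lintegral_indicator_primePowBall_comp_sub {n : ℤ} {c : F} (hc : c ∈ primePowBall F n) (g : F → ℝ≥0∞) :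
    ∫⁻ t, (primePowBall F n).indicator (fun t => g (t - c)) t ∂dx = ∫⁻ u in primePowBall F n, g u ∂dx := by
  haveI : IsTopologicalAddGroup F := inferInstance
  have h := lintegral_add_left_eq_self (μ := dx) (fun t => (primePowBall F n).indicator (fun t => g (t - c)) t) c
  rw [← h, ← lintegral_indicator (measurableSet_primePowBall n)]
  refine lintegral_congr fun u => ?_
  by_cases hu : u ∈ primePowBall F n
  · rw [indicator_of_mem ((add_mem_primePowBall_iff_of_mem hc).2 hu), indicator_of_mem hu, add_sub_cancel_left]
  · rw [indicator_of_notMem (fun h' => hu ((add_mem_primePowBall_iff_of_mem hc).1 h')), indicator_of_notMem hu]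

/-- **`∫ 1_{𝔭^n}(t) ‖t − c‖^{-a} dt = ∫_{𝔭^n} ‖u‖^{-a} du`** for `c ∈ 𝔭^n`. [cite: WeilBNT1967, Ch. I §2] [cite: Tate1950, §2.4] -/
theorem lintegral_indicator_normAbs_sub_rpow_neg {n : ℤ} {c : F} (hc : c ∈ primePowBall F n) (a : ℝ) :
    ∫⁻ t, (primePowBall F n).indicator (fun t => ((normAbs F (t - c) : ℝ≥0∞)) ^ (-a)) t ∂dx =
      ∫⁻ u in primePowBall F n, ((normAbs F u : ℝ≥0∞)) ^ (-a) ∂dx :=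
  lintegral_indicator_primePowBall_comp_sub dx hc fun u => ((normAbs F u : ℝ≥0∞)) ^ (-a)

/-- **`∫ 1_{𝔭^n}(t) ‖t − c₁‖^{-a} ‖t − c₂‖^{-a} dt ≤ 2 ∫_{𝔭^n} ‖u‖^{-2a} du`** for `c₁, c₂ ∈ 𝔭^n` (`uv ≤ u² + v²` and translation). [cite: HarishChandra1970, Part V §6] -/
theorem lintegral_indicator_normAbs_sub_rpow_neg_mul_le {n : ℤ} {c₁ c₂ : F} (hc₁ : c₁ ∈ primePowBall F n) (hc₂ : c₂ ∈ primePowBall F n) (a : ℝ) :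
    ∫⁻ t, (primePowBall F n).indicator (fun t => ((normAbs F (t - c₁) : ℝ≥0∞)) ^ (-a) * ((normAbs F (t - c₂) : ℝ≥0∞)) ^ (-a)) t ∂dx ≤
      2 * ∫⁻ u in primePowBall F n, ((normAbs F u : ℝ≥0∞)) ^ (-(2 * a)) ∂dx := by
  calc ∫⁻ t, (primePowBall F n).indicator (fun t => ((normAbs F (t - c₁) : ℝ≥0∞)) ^ (-a) * ((normAbs F (t - c₂) : ℝ≥0∞)) ^ (-a)) t ∂dx
      ≤ ∫⁻ t, ((primePowBall F n).indicator (fun t => ((normAbs F (t - c₁) : ℝ≥0∞)) ^ (-(2 * a))) t +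
          (primePowBall F n).indicator (fun t => ((normAbs F (t - c₂) : ℝ≥0∞)) ^ (-(2 * a))) t) ∂dx := by
        refine lintegral_mono fun t => ?_
        by_cases ht : t ∈ primePowBall F n
        · rw [indicator_of_mem ht, indicator_of_mem ht, indicator_of_mem ht, ← rpow_neg_sq, ← rpow_neg_sq]
          -- `u v ≤ u² + v²` (as `Literature.Analysis.FluidPDE.ennreal_mul_le_sq_add_sq`, not imported into this p-adic file)
          set u : ℝ≥0∞ := ((normAbs F (t - c₁) : ℝ≥0∞)) ^ (-a)
          set v : ℝ≥0∞ := ((normAbs F (t - c₂) : ℝ≥0∞)) ^ (-a)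
          rcases le_total u v with h | h
          · calc u * v ≤ v * v := by gcongr
              _ = v ^ 2 := (sq v).symm
              _ ≤ u ^ 2 + v ^ 2 := le_add_self
          · calc u * v ≤ u * u := by gcongr
              _ = u ^ 2 := (sq u).symm
              _ ≤ u ^ 2 + v ^ 2 := le_self_add
        · simp only [indicator_of_notMem ht, add_zero, le_refl]
    _ = ∫⁻ u in primePowBall F n, ((normAbs F u : ℝ≥0∞)) ^ (-(2 * a)) ∂dx + ∫⁻ u in primePowBall F n, ((normAbs F u : ℝ≥0∞)) ^ (-(2 * a)) ∂dx := by
        have hm : Measurable fun t : F => (primePowBall F n).indicator (fun t => ((normAbs F (t - c₁) : ℝ≥0∞)) ^ (-(2 * a))) t := by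
          refine Measurable.indicator ?_ (measurableSet_primePowBall n)
          exact (measurable_normAbs.comp (measurable_id.sub_const c₁)).coe_nnreal_ennreal.pow_const _
        rw [lintegral_add_left hm, lintegral_indicator_normAbs_sub_rpow_neg dx hc₁, lintegral_indicator_normAbs_sub_rpow_neg dx hc₂]
    _ = 2 * ∫⁻ u in primePowBall F n, ((normAbs F u : ℝ≥0∞)) ^ (-(2 * a)) ∂dx := (two_mul _).symm

/-! ## §2  The three-variable box integral `∫_{(𝔭^n)³} ‖Δ‖^{-a}`, `Δ(d) = (d₀−d₁)(d₀−d₂)(d₁−d₂)` -/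

/-- **`∫_{(𝔭^n)³} ‖d₀−d₁‖^{-a} ‖d₀−d₂‖^{-a} ‖d₁−d₂‖^{-a} dd ≤ 2 · I(2a) · I(a) · dx(𝔭^n)`**, `I(s) = ∫_{𝔭^n} ‖u‖^{-s} du` (peel `d₀` with the two-centre bound, then
`d₁` by translation). [cite: HarishChandra1970, Part V §6 Thm. 15] [cite: HarishChandra1999AdmissibleDistributions, Lemma 7.9] -/
theorem lintegral_pi_three_indicator_vandermonde_rpow_neg_le (n : ℤ) (a : ℝ) :
    ∫⁻ d : Fin 3 → F, ((primePowBall F n).indicator (1 : F → ℝ≥0∞) (d 0) * (primePowBall F n).indicator (1 : F → ℝ≥0∞) (d 1) *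
        (primePowBall F n).indicator (1 : F → ℝ≥0∞) (d 2)) *
        (((normAbs F (d 0 - d 1) : ℝ≥0∞)) ^ (-a) * ((normAbs F (d 0 - d 2) : ℝ≥0∞)) ^ (-a) * ((normAbs F (d 1 - d 2) : ℝ≥0∞)) ^ (-a))
        ∂(Measure.pi fun _ : Fin 3 => dx) ≤
      2 * (∫⁻ u in primePowBall F n, ((normAbs F u : ℝ≥0∞)) ^ (-(2 * a)) ∂dx) * (∫⁻ u in primePowBall F n, ((normAbs F u : ℝ≥0∞)) ^ (-a) ∂dx) *
        dx (primePowBall F n) := by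
  classical
  haveI : T2Space F := (isLocalField F).toT2Space
  haveI : LocallyCompactSpace F := (isLocalField F).toLocallyCompactSpace
  haveI : SecondCountableTopology F := secondCountableTopology_localField F
  haveI : IsTopologicalRing F := inferInstance
  haveI : SFinite dx := inferInstance
  set B : Set F := primePowBall F n with hB
  have hBm : MeasurableSet B := measurableSet_primePowBall n
  set I₂ : ℝ≥0∞ := ∫⁻ u in B, ((normAbs F u : ℝ≥0∞)) ^ (-(2 * a)) ∂dx with hI₂
  set I₁ : ℝ≥0∞ := ∫⁻ u in B, ((normAbs F u : ℝ≥0∞)) ^ (-a) ∂dx with hI₁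
  -- the integrand and its measurability
  set f : (Fin 3 → F) → ℝ≥0∞ := fun d => (B.indicator (1 : F → ℝ≥0∞) (d 0) * B.indicator (1 : F → ℝ≥0∞) (d 1) * B.indicator (1 : F → ℝ≥0∞) (d 2)) *
    (((normAbs F (d 0 - d 1) : ℝ≥0∞)) ^ (-a) * ((normAbs F (d 0 - d 2) : ℝ≥0∞)) ^ (-a) * ((normAbs F (d 1 - d 2) : ℝ≥0∞)) ^ (-a)) with hf
  have hind : Measurable (B.indicator (1 : F → ℝ≥0∞)) := measurable_one.indicator hBm
  have hpow : ∀ (i j : Fin 3), Measurable fun d : Fin 3 → F => ((normAbs F (d i - d j) : ℝ≥0∞)) ^ (-a) := fun i j =>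
    ((measurable_normAbs.comp ((measurable_pi_apply i).sub (measurable_pi_apply j))).coe_nnreal_ennreal.pow_const _)
  have hfm : Measurable f :=
    (((hind.comp (measurable_pi_apply 0)).mul (hind.comp (measurable_pi_apply 1))).mul (hind.comp (measurable_pi_apply 2))).mul
      (((hpow 0 1).mul (hpow 0 2)).mul (hpow 1 2))
  -- peel `d₀`: `∫ f(update d 0 t) dt ≤ G₁ d := 2 I₂ · 1_B(d₁) 1_B(d₂) ‖d₁−d₂‖^{-a}`
  set G₁ : (Fin 3 → F) → ℝ≥0∞ := fun d => 2 * I₂ * (B.indicator (1 : F → ℝ≥0∞) (d 1) * B.indicator (1 : F → ℝ≥0∞) (d 2) *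
    ((normAbs F (d 1 - d 2) : ℝ≥0∞)) ^ (-a)) with hG₁
  have hG₁m : Measurable G₁ := (((hind.comp (measurable_pi_apply 1)).mul (hind.comp (measurable_pi_apply 2))).mul (hpow 1 2)).const_mul _
  have h10 : (1 : Fin 3) ≠ 0 := by decide
  have h20 : (2 : Fin 3) ≠ 0 := by decide
  have h21 : (2 : Fin 3) ≠ 1 := by decide
  have hstep1 : ∀ d : Fin 3 → F, ∫⁻ t, f (Function.update d 0 t) ∂dx ≤ G₁ d := by
    intro d
    have hupd : ∀ t, f (Function.update d 0 t) = (B.indicator (1 : F → ℝ≥0∞) (d 1) * B.indicator (1 : F → ℝ≥0∞) (d 2) * ((normAbs F (d 1 - d 2) : ℝ≥0∞)) ^ (-a)) *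
        (B.indicator (1 : F → ℝ≥0∞) t * (((normAbs F (t - d 1) : ℝ≥0∞)) ^ (-a) * ((normAbs F (t - d 2) : ℝ≥0∞)) ^ (-a))) := by
      intro t
      simp only [hf, Function.update_self, Function.update_of_ne h10, Function.update_of_ne h20]
      ring
    simp_rw [hupd]
    have hm : Measurable fun t : F => B.indicator (1 : F → ℝ≥0∞) t * (((normAbs F (t - d 1) : ℝ≥0∞)) ^ (-a) * ((normAbs F (t - d 2) : ℝ≥0∞)) ^ (-a)) := by
      refine hind.mul (Measurable.mul ?_ ?_)
      · exact (measurable_normAbs.comp (measurable_id.sub_const (d 1))).coe_nnreal_ennreal.pow_const _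
      · exact (measurable_normAbs.comp (measurable_id.sub_const (d 2))).coe_nnreal_ennreal.pow_const _
    rw [lintegral_const_mul _ hm]
    by_cases hd1 : d 1 ∈ B
    · by_cases hd2 : d 2 ∈ B
      · have hkey := lintegral_indicator_normAbs_sub_rpow_neg_mul_le dx hd1 hd2 a
        have hrew : ∫⁻ t, B.indicator (1 : F → ℝ≥0∞) t * (((normAbs F (t - d 1) : ℝ≥0∞)) ^ (-a) * ((normAbs F (t - d 2) : ℝ≥0∞)) ^ (-a)) ∂dx =
            ∫⁻ t, B.indicator (fun t => ((normAbs F (t - d 1) : ℝ≥0∞)) ^ (-a) * ((normAbs F (t - d 2) : ℝ≥0∞)) ^ (-a)) t ∂dx := by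
          refine lintegral_congr fun t => ?_
          by_cases ht : t ∈ B
          · rw [indicator_of_mem ht, indicator_of_mem ht, Pi.one_apply, one_mul]
          · rw [indicator_of_notMem ht, indicator_of_notMem ht, zero_mul]
        rw [hrew]
        calc B.indicator (1 : F → ℝ≥0∞) (d 1) * B.indicator (1 : F → ℝ≥0∞) (d 2) * ((normAbs F (d 1 - d 2) : ℝ≥0∞)) ^ (-a) *
              ∫⁻ t, B.indicator (fun t => ((normAbs F (t - d 1) : ℝ≥0∞)) ^ (-a) * ((normAbs F (t - d 2) : ℝ≥0∞)) ^ (-a)) t ∂dx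
            ≤ B.indicator (1 : F → ℝ≥0∞) (d 1) * B.indicator (1 : F → ℝ≥0∞) (d 2) * ((normAbs F (d 1 - d 2) : ℝ≥0∞)) ^ (-a) * (2 * I₂) := by
              gcongr
          _ = G₁ d := by simp only [hG₁]; ring
      · have h0 : B.indicator (1 : F → ℝ≥0∞) (d 2) = 0 := indicator_of_notMem hd2 _
        rw [h0]; simp
    · have h0 : B.indicator (1 : F → ℝ≥0∞) (d 1) = 0 := indicator_of_notMem hd1 _
      rw [h0]; simp
  -- peel `d₁`: `∫ G₁(update d 1 t) dt ≤ G₂ d := 2 I₂ I₁ · 1_B(d₂)`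
  set G₂ : (Fin 3 → F) → ℝ≥0∞ := fun d => 2 * I₂ * I₁ * B.indicator (1 : F → ℝ≥0∞) (d 2) with hG₂
  have hstep2 : ∀ d : Fin 3 → F, ∫⁻ t, G₁ (Function.update d 1 t) ∂dx ≤ G₂ d := by
    intro d
    have hupd : ∀ t, G₁ (Function.update d 1 t) = (2 * I₂ * B.indicator (1 : F → ℝ≥0∞) (d 2)) *
        (B.indicator (1 : F → ℝ≥0∞) t * ((normAbs F (t - d 2) : ℝ≥0∞)) ^ (-a)) := by
      intro t
      simp only [hG₁, Function.update_self, Function.update_of_ne h21]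
      ring
    simp_rw [hupd]
    have hm : Measurable fun t : F => B.indicator (1 : F → ℝ≥0∞) t * ((normAbs F (t - d 2) : ℝ≥0∞)) ^ (-a) := by
      refine hind.mul ?_
      exact (measurable_normAbs.comp (measurable_id.sub_const (d 2))).coe_nnreal_ennreal.pow_const _
    rw [lintegral_const_mul _ hm]
    by_cases hd2 : d 2 ∈ B
    · have hrew : ∫⁻ t, B.indicator (1 : F → ℝ≥0∞) t * ((normAbs F (t - d 2) : ℝ≥0∞)) ^ (-a) ∂dx =
          ∫⁻ t, B.indicator (fun t => ((normAbs F (t - d 2) : ℝ≥0∞)) ^ (-a)) t ∂dx := by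
        refine lintegral_congr fun t => ?_
        by_cases ht : t ∈ B
        · rw [indicator_of_mem ht, indicator_of_mem ht, Pi.one_apply, one_mul]
        · rw [indicator_of_notMem ht, indicator_of_notMem ht, zero_mul]
      rw [hrew, lintegral_indicator_normAbs_sub_rpow_neg dx hd2]
      change 2 * I₂ * B.indicator (1 : F → ℝ≥0∞) (d 2) * I₁ ≤ 2 * I₂ * I₁ * B.indicator (1 : F → ℝ≥0∞) (d 2)
      rw [mul_right_comm]
    · have h0 : B.indicator (1 : F → ℝ≥0∞) (d 2) = 0 := indicator_of_notMem hd2 _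
      rw [h0]; simp
  -- assemble with `lmarginal`
  have huniv : (Finset.univ : Finset (Fin 3)) = insert 0 (insert 1 {2}) := by decide
  have h0 : (0 : Fin 3) ∉ (insert 1 {2} : Finset (Fin 3)) := by decide
  have h1 : (1 : Fin 3) ∉ ({2} : Finset (Fin 3)) := by decide
  set x₀ : Fin 3 → F := fun _ => 0 with hx₀
  rw [lintegral_eq_lmarginal_univ x₀, huniv, lmarginal_insert' _ hfm h0]
  calc (∫⋯∫⁻_insert 1 {2}, (fun d => ∫⁻ t, f (Function.update d 0 t) ∂dx) ∂fun _ : Fin 3 => dx) x₀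
      ≤ (∫⋯∫⁻_insert 1 {2}, G₁ ∂fun _ : Fin 3 => dx) x₀ := lmarginal_mono (fun d => hstep1 d) x₀
    _ = (∫⋯∫⁻_{2}, (fun d => ∫⁻ t, G₁ (Function.update d 1 t) ∂dx) ∂fun _ : Fin 3 => dx) x₀ := by rw [lmarginal_insert' _ hG₁m h1]
    _ ≤ (∫⋯∫⁻_{2}, G₂ ∂fun _ : Fin 3 => dx) x₀ := lmarginal_mono (fun d => hstep2 d) x₀
    _ = ∫⁻ t, G₂ (Function.update x₀ 2 t) ∂dx := by rw [lmarginal_singleton]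
    _ = 2 * I₂ * I₁ * dx B := by
        simp only [hG₂, Function.update_self]
        rw [lintegral_const_mul _ hind, lintegral_indicator_one hBm]

/-- **`∫_{(𝔭^n)³} ‖d₀−d₁‖^{-a} ‖d₀−d₂‖^{-a} ‖d₁−d₂‖^{-a} dd < ∞` for `a < 1/2`** (★ `∫_{𝔭^n} ‖u‖^{-s} < ∞` for `s < 1`, at `s = 2a` and `s = a`).
[cite: HarishChandra1970, Part V §6 Thm. 15] [cite: Tate1950, §2.4] -/
theorem lintegral_pi_three_indicator_vandermonde_rpow_neg_lt_top (n : ℤ) {a : ℝ} (ha : a < 1 / 2) :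
    ∫⁻ d : Fin 3 → F, ((primePowBall F n).indicator (1 : F → ℝ≥0∞) (d 0) * (primePowBall F n).indicator (1 : F → ℝ≥0∞) (d 1) *
        (primePowBall F n).indicator (1 : F → ℝ≥0∞) (d 2)) *
        (((normAbs F (d 0 - d 1) : ℝ≥0∞)) ^ (-a) * ((normAbs F (d 0 - d 2) : ℝ≥0∞)) ^ (-a) * ((normAbs F (d 1 - d 2) : ℝ≥0∞)) ^ (-a))
        ∂(Measure.pi fun _ : Fin 3 => dx) < ∞ := by
  haveI : T2Space F := (isLocalField F).toT2Space
  haveI : LocallyCompactSpace F := (isLocalField F).toLocallyCompactSpace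
  refine (lintegral_pi_three_indicator_vandermonde_rpow_neg_le dx n a).trans_lt ?_
  have h2 : ∫⁻ u in primePowBall F n, ((normAbs F u : ℝ≥0∞)) ^ (-(2 * a)) ∂dx < ∞ := lintegral_coe_normAbs_rpow_neg_lt_top dx (by linarith) n
  have h1 : ∫⁻ u in primePowBall F n, ((normAbs F u : ℝ≥0∞)) ^ (-a) ∂dx < ∞ := lintegral_coe_normAbs_rpow_neg_lt_top dx (by linarith) n
  exact ENNReal.mul_lt_top (ENNReal.mul_lt_top (ENNReal.mul_lt_top ENNReal.ofNat_lt_top h2) h1) (measure_primePowBall_lt_top dx n)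

end OneVariable

/-! ## §3  The slice `b(r)`: upper-triangularity and `disc χ_{b(r)} = Δ(r₀,r₃,r₅)²` -/

section Slice

variable {K : Type*} [Field K]

/-- `b(r) = [[r₀,r₁,r₂],[0,r₃,r₄],[0,0,r₅]]` is upper triangular. [folklore] -/
theorem blockTriangular_borelSlice (r : Fin 6 → K) :
    (!![r 0, r 1, r 2; 0, r 3, r 4; 0, 0, r 5] : Matrix (Fin 3) (Fin 3) K).BlockTriangular id := by
  intro i j hij
  fin_cases i <;> fin_cases j <;> simp at hij ⊢

/-- `χ_{b(r)} = χ_{diag(r₀,r₃,r₅)}` (both are `∏ (X − rᵢᵢ)`). [cite: HarishChandra1970, Part I §5] -/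
theorem charpoly_borelSlice (r : Fin 6 → K) :
    (!![r 0, r 1, r 2; 0, r 3, r 4; 0, 0, r 5] : Matrix (Fin 3) (Fin 3) K).charpoly = (Matrix.diagonal ![r 0, r 3, r 5]).charpoly := by
  rw [Matrix.charpoly_of_upperTriangular _ (blockTriangular_borelSlice r), Matrix.charpoly_diagonal, Fin.prod_univ_three, Fin.prod_univ_three]
  simp

/-- **`disc χ_{b(r)} = Δ(r₀,r₃,r₅)²`**, `Δ(d) = (d₀−d₁)(d₀−d₂)(d₁−d₂)` (★ H1a `discr_charpoly_diagonal`). [cite: HarishChandra1970, Part I §5] -/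
theorem discr_charpoly_borelSlice (r : Fin 6 → K) :
    (!![r 0, r 1, r 2; 0, r 3, r 4; 0, 0, r 5] : Matrix (Fin 3) (Fin 3) K).charpoly.discr = ((r 0 - r 3) * (r 0 - r 5) * (r 3 - r 5)) ^ 2 := by
  rw [charpoly_borelSlice, discr_charpoly_diagonal]
  simp

end Slice

end Summit.HodgeConjecture.HodgeConjecture.Cruxes.H413.K2E3GL3SplitDiscriminantBoxIntegral

end
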